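import Mathlib
import HarnessLib
import HarnessLib.Audit
import Summits.ABC.ABC.Statement

/-!
Route: BelyiDegreeSmooth

CLOSED (retired) 2026-08-15T13:30:38Z by operator:999:774649 — reason: not-a-thesis: assembly does not conclude the sub-problem Statement — note: D-0027 §2.1 audit (human 2026-08-15: routes that do not decide the summit are removed): the assembly concludes `XYZLowerBound`, not the sub-problem statement; a NEW conforming route may be opened from the same idea (generated `closes : … → _root_.ABC`).. The file is kept as the record of this route; refuted decls are indexed as negative knowledge (`ledger negatives`).

Route BelyiDegreeSmooth — realises idea card ABC/ABC/belyi-degree-smooth-regime (Belyi degree of the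
Frey point; smooth-regime engine with Beckmann's ceiling).

THESIS X = JavanpeykarFreyBound ∧ SmoothBelyiUniformity. "It suffices to show X" for the TARGET
XYZLowerBound := ∃ K C, log c ≤ C·P(abc)^K for every abc triple (P(abc) = largest prime factor),
i.e. the positivity half κ₀ > 0 of the Lagarias–Soundararajan xyz conjecture
(LagariasSoundararajan2011, 'XYZ conjecture, weak form-2'; κ₀ := liminf log P(abc)/loglog c,
conjecturally 3/2). HONEST SCOPE: the target is a WAYPOINT implied by ABC (abc ⟹ κ₀ ≥ 1, loc. cit.
Thm 1.1, i.e. K = 1) and is NOT Summit.ABC — Beckmann's floor deg_B ≥ P(abc) (support item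
BeckmannFloor) caps every Belyi-degree argument at log c ≪ poly(P(abc)); the route is a
smooth-regime ENGINE. State of the art it would supersede: P(abc) ≫ (log₂c)²/log₃c (Pasten2024 Cor
1.5, from Thm 1.4(2); Stewart–Yu before); the target gives P(abc) ≥ (log c/C)^{1/K}, exponentially
stronger, in the regime where linear forms in π(P) logarithms are weakest.

MECHANISM. (J) Javanpeykar2014 Thm 1.1.1 (stable Faltings height h_Fal(X) ≤ 13·10⁶·g·deg_B(X)⁵ for
every curve X/ℚ̄ of genus g ≥ 1) applied to the Legendre/Frey curve E_λ, λ = a/c, together with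
Silverman1986 (h(j_E) ≤ 12 h_Fal(E) + 6 log(1+h(j_E)) + O(1)), h(j_λ) ≥ 6 log c − 1
(gcd(256(a²+ab+b²)³, a²b²c²) | 256) and deg_B(E_λ) ≤ 2·deg_B(ℙ¹; 0,1,∞,λ) (compose x with the
witness) gives UNCONDITIONALLY log c ≤ C₁·deg_B(a/c)⁵ + C₂ — crux JavanpeykarFreyBound, a theorem in
print to be imported as a named fact (filed FIRST per the plancard rule: the route's import cone is
gated on it). (BU) The bet, crux SmoothBelyiUniformity: deg_B(ℙ¹; 0,1,∞,a/c) ≤ C·P(abc)^K —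
'Beckmann's floor is sharp up to a polynomial for smooth rationals'. Calibration (by hand, this
session): β = 27x²(1−x)/4 has special set {0,1,∞,2/3,−1/3}; its cross-ratios 9, −8, 4, −3, 3, −2
show that ALL FOUR {2,3}-smooth triples (1,1,2),(1,2,3),(1,3,4),(1,8,9) have deg_B = 3 = P(abc)
exactly (height 9 at degree 3). ASSEMBLY (J) → (BU) → target is two lines of real algebra,
machine-checked in the planner's Sketch.lean (theorem assembly_holds, rc 0). DICHOTOMY PARTNER
(negative side, ranked): SpecialHeightsPolynomial — rational special cross-ratios of degree-d
genus-0 dessins have height ≤ d^A — refutes (BU) on the unconditional smooth family (1, 2^{k!}−1,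
2^{k!}) (P(abc) = c^{O(1/log k)}) and is the rigidity half, with exponent 1/A, of the sibling card
belyi-szpiro-squeeze; exactly one of the two ranked bets survives, and one dessin enumeration
(Λ_{≤7} ∩ ℚ vs the twelve {2,3,5}-smooth triples with 6 ≤ c ≤ 128, de Weger's list) is the first
adjudication.

LEAN (all decls elaborate; Sketch.lean rc 0). 'a/c has a Belyi witness of degree d' is INLINED in
every signature as W(d,t) := ∃ p q : Polynomial ℂ, IsCoprime p q ∧ max p.natDegree q.natDegree = d ∧
(p.natDegree < d ∨ q.natDegree < d ∨ (p − q).natDegree < d) ∧ (p*q*(p−q)).roots.toFinset.card = d +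
1 ∧ (p*q*(p−q)).eval 0 = 0 ∧ (p*q*(p−q)).eval 1 = 0 ∧ (p*q*(p−q)).eval t = 0 — β = p/q of degree d
has #β⁻¹{0,1,∞} = (distinct roots of p·q·(p−q)) + [∞, present iff a degree drops] = d + 2, the
Riemann–Hurwitz equality case, i.e. β is unramified outside {0,1,∞}, with 0, 1, ∞, t special
(definition request HasBelyiWitness/belyiDegree filed).
X as one line: (∃ C₁ C₂ : ℝ, ∀ a b c d : ℕ, IsABCTriple a b c → W(d, a/c) → Real.log c ≤ C₁ * d ^ 5
+ C₂) ∧ (∃ (K : ℕ) (C : ℝ), ∀ a b c, IsABCTriple a b c → ∀ P : ℕ, (∀ p ∈ (a*b*c).primeFactors, p ≤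
P) → ∃ d : ℕ, (d : ℝ) ≤ C * P ^ K ∧ W(d, a/c)).
Target: ∃ (K : ℕ) (C : ℝ), ∀ a b c, IsABCTriple a b c → ∀ P : ℕ, (∀ p ∈ (a*b*c).primeFactors, p ≤ P)
→ Real.log c ≤ C * P ^ K.

Rationale: WHY THIS LINE. The smooth regime (all primes of abc ≤ P, exponents huge) is where every catalogued
engine is weakest: Baker/Yu pay a product of π(P) heights (Stewart–Yu: P ≫ loglog c; Pasten2024 Cor
1.5: P ≫ (log₂c)²/log₃c), while ABC predicts P ≥ (1−ε)log c and the xyz heuristic P ≈ (log c)^{3/2}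
(LagariasSoundararajan2011). This route imports ARAKELOV THEORY OF BELYI CURVES (Javanpeykar2014:
all Arakelov invariants ≤ poly(deg_B), uniform — no field, no conductor) and moves the whole
Diophantine burden into ONE combinatorial-topological integer, the minimal degree of a genus-0
dessin drawing {0,1,∞,a/c}; Beckmann1989/Zapponi2009BelyiDegree/Rodriguez2013 make the prime SUPPORT
of abc (not the exponents) the thing a dessin must pay for — the abc philosophy realised by the
group theory of S_d. Used from the catalogue: geometric lift (Frey/Legendre curve as a
height-to-dessin converter) + a regime decomposition (this is the smooth-regime piece; its
complement is NOT claimed). No spectral/probabilistic reformulation: none speaks to smooth triples.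
RANKED CRUXES. rank 2 JavanpeykarFreyBound (GATING NAMED FACT, filed first per plancard rule:
theorem in print modulo the composite h(j) ↔ h_Fal ↔ deg_B bookkeeping; nothing is served to provers
until it lands as a Literature fact). rank 3 SmoothBelyiUniformity (BU) — THE BET and the hardest
item: no construction mechanism is known beyond P = 3 (where it is Beckmann-sharp for all four
triples); tools named: compositions of x ↦ x^p, 1−x, 1/x, Chebyshev/dihedral/Lattès and dynamical
Belyi maps with monodromy a {p ≤ P}-group (Beckmann/Raynaud converse), searched by factorisation not
by size; p-adic rigidity of three-point covers (any ℂ_p-analytic three-point cover is algebraic over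
ℚ̄) as a construction principle. rank 4 SpecialHeightsPolynomial (SHL) — NEGATIVE SIDE, staffed
deliberately: heights of rational special cross-ratios are polynomial in the degree; all known
constructions (Belyi1980 β_{a,b}: height = degree; Khadjavi2002 towers) satisfy it, no lower bound
beyond (log H)^{1/5} (Javanpeykar) and P(abc) (Beckmann) is known; SHL ⟹ ¬BU via
(1,2^{k!}−1,2^{k!}); SHL is also what card belyi-szpiro-squeeze needs with A = 1+ε. Support:
BelyiTrivialBound (β_{a,b}, provable now; certifies the inlined witness is inhabited at d = c),
BeckmannFloor (the ceiling; named-fact territory), Assembly (pure algebra, proved in Sketch.lean).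
NUMBERS. Javanpeykar: h_Fal ≤ 13·10⁶ g d⁵ ⟹ C₁ ≈ 2·13·10⁶·2⁵ ≈ 8.4·10⁸ before log-absorption. BU
forces K ≥ 1 (λ = 1/p: deg_B ≥ p = P). Route output: κ₀ ≥ 1/(5K) ≤ 1/5 (truth 3/2; ABC gives 1). de
Weger (doi:10.1016/0022-314X(87)90088-6): 545 primitive solutions with P ≤ 13; the {2,3,5}-list to
test:
(1,5,6),(3,5,8),(4,5,9),(1,9,10),(1,15,16),(1,24,25),(9,16,25),(2,25,27),(5,27,32),(1,80,81),(3,125,128)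
— deg_B ∈ [5, c].
KILL CRITERIA. (i) SHL proved, or any smooth family with deg_B(a/c) ≥ exp(P(abc)^δ) ⟹ BU refuted ⟹
close `refuted:SmoothBelyiUniformity`, catalogue the Beckmann ceiling + anti-Belyi as a barrier,
hand SHL to belyi-szpiro-squeeze. (ii) Cheapest test (refuter, kit/LMFDB doi:10.2140/obs.2019.2.375,
or Bétréma–Péré–Zvonkin tree catalogues for the polynomial case): enumerate genus-0 dessins of
degree ≤ 7, list rational special cross-ratios Λ_{≤7} ∩ ℚ; if none of 16, 25, 27/2, 32/5, 81, 128/3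
(or orbit-mates) appears by degree 7 while heights in Λ_{≤d} stay ≤ d², record `suspect-false` on
BU. (iii) JavanpeykarFreyBound found mis-assembled (e.g. only C₁d⁵log d) ⟹ restate, harmless. (iv)
XYZLowerBound proved by another method ⟹ route superseded (BU/SHL stay as dessin questions).
NOT DECOMPOSED (deliberately). No per-prime/local split of BU (no patching mechanism yet); no
quasi-polynomial rung of BU (any deg_B ≤ exp(o(√P)) already beats Pasten via (J) — provers may file
it with --supports); no complement regime (large prime) — that is ABC itself and is not claimed; the
Faltings-height chain is one named fact, not three items.
NOVELTY/BARRIERS: see the dedicated sections (searched 2026-08-15; new-combination: Javanpeykar2014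
× Beckmann floor × Frey, target identified with κ₀ > 0 of LagariasSoundararajan2011, dichotomy
BU/SHL shared with belyi-szpiro-squeeze).

Novelty: Searched 2026-08-15: lit read arXiv:1403.6404 pp.3-4,18-19 (Thm 1.1.1, 4.5.1-2), arXiv:2312.03566
p.3 (Thm 1.4, Cor 1.5), arXiv:0911.4147 pp.3-5 (xyz weak forms 1-2, κ₀ = 3/2 strong form, Thm 1.1
abc ⟹ κ₀ ≥ 1, GRH ⟹ κ₀ ≤ 8); lit search --hybrid 'Belyi degree rational number lower bound height
dessin' (B–G, Zannier, Silverman: nothing on minimal Belyi degree of rationals); zbmath 'Belyi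
degree algebraic number' (doi:10.1090/conm/722/14533 computability, doi:10.2140/obs.2019.2.375 LMFDB
db, Adrianov–Zvonkin trees: none ties deg_B to smoothness); lit frontier/bridges ABC (no Belyi/xyz
descendants); galaxy pdf 'Belyi degree' 0 hits (panama timed out); plus the card's audits
(Rodriguez2013, Liţcanu 2004, Zapponi2009BelyiDegree, Javanpeykar–von Känel arXiv:1311.0043 §4:
chain run height → deg_B → Arakelov, the opposite direction). Nearest prior art: Javanpeykar2014 Thm
1.1.1; Beckmann1989/Zapponi2009BelyiDegree/Rodriguez2013 (deg_B ≥ largest bad prime = our support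
item, not a finding); LagariasSoundararajan2011 (target κ₀ > 0 posed, no Belyi maps); Pasten2024
(bound to beat). Delta: (1) the inverted chain — a conjectured smooth-uniform upper bound on
deg_B(a/c) fed into Javanpeykar on the Legendre/Frey curve outputs κ₀ > 0, identified with the named
xyz conjecture; (2) the ranked dichotomy BU vs SpecialHeightsPolynomial on M(d) = max height of a
rational special cross-ratio of a degree-d dessin (log d ≤ M(d) ≤ min(C d⁵, max{log c : P(abc) ≤
d})), adjudication shared with card bely  [refs: 10.1090/conm/722/14533, 10.2140/obs.2019.2.375, 1403.6404, 2312.03566, 0911.4147, 1311.0043, doi:10.1090/conm/722/14533, doi:10.2140/obs.2019.2.375, Rodriguez2013, Javanpeykar2014, Beckmann1989, LagariasSoundararajan2011, Pasten2024]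

Barriers (technique_class: belyi-degree dessins arakelov-belyi-curves smooth-regime): technique_class: belyi-degree dessins arakelov-belyi-curves smooth-regime
- Literature.Barriers.ABC.BakerMethodBounds: different class — no linear forms in logarithms (height
enters via Arakelov theory of a Belyi cover, Javanpeykar2014; the radical's support via Beckmann
good reduction); it is only the benchmark to beat in the smooth regime (exp(O(√(P log P))) vs P^K).
- Literature.Barriers.ABC.EpsilonCannotBeDropped: not engaged — target ∃K ∃C log c ≤ C·P(abc)^K has
free constant and exponent, implied by ABC with room (K = 1); Stewart–Tijdeman witnesses (ω → ∞)
satisfy it.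
- Literature.Barriers.ABC.SzpiroEpsilonCannotBeDropped: not engaged — no fixed-exponent
discriminant–conductor inequality is asserted.
- Literature.Barriers.ABC.IntegersHaveNoDerivation: Riemann–Hurwitz only on honest curves over ℂ/ℚ̄
(the witness W(d,t) IS the RH equality case for β : ℙ¹ → ℙ¹; E_λ → ℙ¹); passage to ℤ = Javanpeykar's
Arakelov intersection theory on regular models (a theorem), no derivation on ℤ, no polynomial
analogy.
- Literature.Barriers.ABC.MasonStothersFailsInCharP: no char-p transfer; reduction mod p only inside
Beckmann's theorem for p ∤ |Mon(β)| (p > d, tame), support item BeckmannFloor.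
- Literature.Barriers.ABC.ExplicitABCQualityFloor, Literature.Barriers.ABC.BakerShapeConstantFloor:
irrelevant (no explicit-constant claims).
- SELF-DECLARED CEILING (catalogue when BeckmannFloor lands): deg_B(a/c) ≥ P(abc) ⟹ a polynomial
Javanpeykar bound can never give more than log c ≪ poly(P(abc

History (route lifecycle, newest last):
- 2026-08-15T13:30:38Z · CLOSED retired — not-a-thesis: assembly does not conclude the sub-problem Statement (operator:999:774649)

sub-problem: ABC · status: closed(retired) · opened planner-plancard-ABC-ABC-belyi-degree-smooth--189adf33-0 2026-08-15T11:02:41Z · rev 1 · ledger route-ABC-BelyiDegreeSmooth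
GENERATED by the gate from the ledger (D-0016/17). Provers cite these decls: `theorem foo : Summit.ABC.ABC.Theses.BelyiDegreeSmooth.<Decl> := …` in Summits/ABC/ABC/Theorems/<Name>.lean.
-/

namespace Summit.ABC.ABC.Theses.BelyiDegreeSmooth

open scoped BigOperators Topology Manifold Classical MeasureTheory ProbabilityTheory Matrix InnerProductSpace ComplexConjugate ContinuousMap
open Filter Set Function TopologicalSpace MeasureTheory

attribute [summit_statement] _root_.ABC

open Literature.Abc

/-- item stmt-ABC-2244 · target · rank 0 · closed · moot by None · by planner
why it might fail: Positivity half κ₀>0 of the xyz conjecture (LagariasSoundararajan2011, weak form-2), open; best unconditional P(abc) ≫ (log₂c)²/log₃c (Pasten2024 Cor 1.5). Via this route it needs BU, which SpecialHeightsPolynomial or BelyiSqueeze.DegBelyiLower would refute. ABC gives it with K=1 (Thm 1.1).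
sources: LagariasSoundararajan2011, Pasten2024, StewartYu2001, arXiv:0911.4147, arXiv:2312.03566
[target] POLYNOMIAL-IN-LARGEST-PRIME abc = positivity half of the Lagarias–Soundararajan xyz
conjecture: ∃ K C such that every abc triple satisfies log c ≤ C·P(abc)^K, P(abc) = largest prime
factor of abc (stated with any P ≥ all prime factors). Equivalently κ₀ := liminf log P(abc)/loglog c
≥ 1/K > 0 (LagariasSoundararajan2011 'XYZ conjecture weak form-2', positivity part; strong form κ₀ =
3/2). Implied by ABC with K = 1 (loc. cit. Thm 1.1: abc ⟹ κ₀ ≥ 1, since rad ≤ e^{θ(P)} ≤ e^{1.02P});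
NOT conversely — this is a WAYPOINT, the honest terminus of any Belyi-degree argument
(BeckmannFloor). State of the art: P(abc) ≫ (log₂c)²/log₃c (Pasten2024 Thm 1.4(2)/Cor 1.5), before
that Stewart–Yu (StewartYu2001); the target is exponentially stronger. This route delivers K =
5·K_BU ≥ 5 (κ₀ ≥ 1/5 at best). Natural support input for regime-decomposition cards
(giant-exponent-large-prime-regime, counterexample-atlas-bounded-omega: the smooth / bounded-support
cell). -/
@[route_item "route-ABC-BelyiDegreeSmooth"]
def XYZLowerBound : Prop :=
  ∃ (K : ℕ) (C : ℝ), ∀ a b c : ℕ, Literature.NumberTheory.DiophantineGeometry.IsABCTriple a b c → ∀ P : ℕ, (∀ p ∈ (a * b * c).primeFactors, p ≤ P) → Real.log (c : ℝ) ≤ C * (P : ℝ) ^ K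

/-- item stmt-ABC-2246 · crux · rank 3 · closed · moot by None · by planner
why it might fail: No mechanism compresses deg_B(a/c) below Belyi's d ≤ c beyond P ≤ 3; every known bound tracks HEIGHT (Belyi1980, Khadjavi2002). Sibling crux BelyiSqueeze.DegBelyiLower (c ≤ C_ε·deg_B^{1+ε}) or SpecialHeightsPolynomial refutes it on (1,2^{k!}−1,2^{k!}); a smooth family with deg_B ≥ exp(P^δ) kills it.
sources: Belyi1980, Khadjavi2002, Beckmann1989, Zapponi2009BelyiDegree, Rodriguez2013, doi:10.2140/obs.2019.2.375
[crux — THE BET (BU, 'smooth Belyi uniformity'), hardest item] ∃ K C: for every abc triple and every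
P ≥ all prime factors of abc, a/c has a Belyi witness of degree d ≤ C·P^K (normal form W(d, a/c));
i.e. deg_B(ℙ¹;0,1,∞,a/c) ≤ C·P(abc)^K: Beckmann's floor deg_B ≥ P(abc) (BeckmannFloor) is sharp up
to a polynomial. K ≥ 1 forced (λ = 1/p). Calibration (by hand): β = 27x²(1−x)/4 has special set
{0,1,∞,2/3,−1/3} with cross-ratios 9,−8,4,−3,3,−2, so all four {2,3}-smooth triples have deg_B =
P(abc): sharp. FASTEST REFUTATION (kit or LMFDB Belyi db doi:10.2140/obs.2019.2.375): enumerate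
genus-0 dessins of degree ≤ 7, extract the rational cross-ratios of 4 special points, compare with
the eleven {2,3,5}-smooth triples 6 ≤ c ≤ 128 (de Weger 1987; listed in the rationale), deg_B ∈
[5,c]. None of 16, 25, 27/2, 32/5, 81, 128/3 (or orbit-mates) by degree 7 with special heights ≤ d²
⟹ suspect-false; deg_B(3/128) ≤ 7 ⟹ BU lives. Tools (none established): compositions of x^p, 1−x,
1/x, Chebyshev/Lattès/dynamical Belyi maps with {p ≤ P}-group monodromy; p-adic analytic three-point
covers (rigid ⟹ algebraic) with prescribed collision depths v_p(abc). -/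
@[route_item "route-ABC-BelyiDegreeSmooth"]
def SmoothBelyiUniformity : Prop :=
  ∃ (K : ℕ) (C : ℝ), ∀ a b c : ℕ, Literature.NumberTheory.DiophantineGeometry.IsABCTriple a b c → ∀ P : ℕ, (∀ p ∈ (a * b * c).primeFactors, p ≤ P) → ∃ d : ℕ, (d : ℝ) ≤ C * (P : ℝ) ^ K ∧ ∃ p q : Polynomial ℂ, IsCoprime p q ∧ max p.natDegree q.natDegree = d ∧ (p.natDegree < d ∨ q.natDegree < d ∨ (p - q).natDegree < d) ∧ (p * q * (p - q)).roots.toFinset.card = d + 1 ∧ (p * q * (p - q)).eval 0 = 0 ∧ (p * q * (p - q)).eval 1 = 0 ∧ (p * q * (p - q)).eval ((a : ℂ) / (c : ℂ)) = 0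

/-- item stmt-ABC-2247 · crux · rank 4 · closed · moot by None · by planner
why it might fail: False once degree-d genus-0 dessins carry rational special cross-ratios of height exp(d^δ) (e.g. if BU holds): P=3 is Beckmann-sharp at height d² (deg_B(8/9)=3), the only proved ceiling is h ≪ d⁵ (Javanpeykar2014 Thm 1.1.1), no rigidity closing the log d vs d⁵ gap is known; LMFDB (deg ≤ 9) untested.
sources: Javanpeykar2014, Beckmann1989, Rodriguez2013, Zapponi2009BelyiDegree, Khadjavi2002, doi:10.2140/obs.2019.2.375
[crux — NEGATIVE SIDE / dichotomy partner of SmoothBelyiUniformity, ranked so that it is staffed]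
SHL: ∃ A C: for every abc triple and every Belyi witness of degree d for a/c (normal form W(d,
a/c)), log c ≤ A·log d + C; i.e. deg_B(ℙ¹;0,1,∞,a/c) ≥ (c·e^{−C})^{1/A} — 'anti-Belyi': Belyi's
degree-c construction is optimal up to the exponent. All known constructions satisfy it (β_{a,b}:
log c = log d; P = 3 data force A ≥ 2); known lower bounds: only (log c/C₁)^{1/5}
(JavanpeykarFreyBound) and P(abc) (BeckmannFloor). CONSEQUENCES: (i) SHL ⟹ ¬SmoothBelyiUniformity
via the unconditional smooth family (1, 2^n−1, 2^n), n = k!, where P(2^n−1) ≤ 2·2^{φ(n)} =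
c^{O(1/log k)} (2^n−1 = ∏_{m|n} Φ_m(2)): proving SHL BREAKS this route (Beckmann ceiling + SHL then
become a catalogued barrier); (ii) SHL with A = 1+ε is the rigidity half (BS) of card
belyi-szpiro-squeeze, which with a radical-sized upper bound reaches ABC. With M(d) := max{log c :
a/c a rational special cross-ratio of a genus-0 dessin of degree ≤ d}: log d ≤ M(d) ≤ min(C₁d⁵ + C₂,
max{log c : P(abc) ≤ d}); SHL says M(d) = O(log d), BU needs M(d) ≥ d^δ; the BU enumeration measures
M(d) for d ≤ 7 (M(2) = log 2, M(3) = log 9). -/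
@[route_item "route-ABC-BelyiDegreeSmooth"]
def SpecialHeightsPolynomial : Prop :=
  ∃ A C : ℝ, ∀ a b c d : ℕ, Literature.NumberTheory.DiophantineGeometry.IsABCTriple a b c → ∀ p q : Polynomial ℂ, IsCoprime p q → max p.natDegree q.natDegree = d → (p.natDegree < d ∨ q.natDegree < d ∨ (p - q).natDegree < d) → (p * q * (p - q)).roots.toFinset.card = d + 1 → (p * q * (p - q)).eval 0 = 0 → (p * q * (p - q)).eval 1 = 0 → (p * q * (p - q)).eval ((a : ℂ) / (c : ℂ)) = 0 → Real.log (c : ℝ) ≤ A * Real.log (d : ℝ) + C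

/-- item stmt-ABC-2245 · support · rank 2 · closed · moot by None · by planner
why it might fail: Middle link is a published theorem (Javanpeykar2014 Thm 1.1.1); risk = bookkeeping of the composite: stable Faltings height vs h(j) (Silverman1986, log-loss), deg_B(E_λ) ≤ 2d, and that the inlined witness W(d,t) is exactly 'Belyi with 0,1,∞,t special'. May land as C₁d⁵log d — restate then.
sources: Javanpeykar2014, arXiv:1403.6404, Silverman1986, Belyi1980, Zapponi2009BelyiDegree, arXiv:math/0108222
[crux — GATING NAMED FACT, filed first per the plancard rule; known theorem modulo assembly] ∃ C₁
C₂: for every abc triple and every Belyi witness of degree d for λ = a/c (β = p/q on ℙ¹ of degree d,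
unramified outside {0,1,∞}, with 0,1,∞,a/c special — inlined normal form W(d,t), see thesis), log c
≤ C₁·d⁵ + C₂. In print modulo assembly: Javanpeykar2014 (arXiv:1403.6404) Thm 1.1.1, h_Fal(X) ≤
13·10⁶·g·deg_B(X)⁵ for X/ℚ̄ of genus g ≥ 1 (stable Faltings height), applied to E_λ : y² =
x(x−1)(x−λ) with deg_B(E_λ) ≤ 2d (compose x : E_λ → ℙ¹, branched over {0,1,λ,∞}, with β);
Silverman1986 Prop 2.1, h(j_E) ≤ 12·h_Fal(E) + 6·log(1+h(j_E)) + O(1); and h(j_λ) =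
h(256(a²−ac+c²)³/(a²c²(c−a)²)) ≥ 6 log c − 7 (gcd | 256, a²−ac+c² ≥ 3c²/4). So log c ≤
2·13·10⁶·32·d⁵ + log(1+7 log c) + O(1): C₁ ≈ 8.4·10⁸ after absorbing the log (if it only lands as
C₁d⁵log d, restate). Ledger life: a grounder files the corollary (or Thm 1.1.1 + Silverman) as a
named Literature fact; then this item is restated as `fact → …` or the Assembly carries the
hypothesis. It is the ENGINE (Arakelov theory of Belyi covers: Merkl's Green-function bounds, a
small non-Weierstrass point, Lenstra's different bound). -/
@[route_item "route-ABC-BelyiDegreeSmooth"]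
def JavanpeykarFreyBound : Prop :=
  ∃ C₁ C₂ : ℝ, ∀ a b c d : ℕ, Literature.NumberTheory.DiophantineGeometry.IsABCTriple a b c → ∀ p q : Polynomial ℂ, IsCoprime p q → max p.natDegree q.natDegree = d → (p.natDegree < d ∨ q.natDegree < d ∨ (p - q).natDegree < d) → (p * q * (p - q)).roots.toFinset.card = d + 1 → (p * q * (p - q)).eval 0 = 0 → (p * q * (p - q)).eval 1 = 0 → (p * q * (p - q)).eval ((a : ℂ) / (c : ℂ)) = 0 → Real.log (c : ℝ) ≤ C₁ * (d : ℝ) ^ 5 + C₂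

/-- item stmt-ABC-2248 · support · rank 9 · closed · moot by None · by planner
sources: Belyi1980, Khadjavi2002
[support — provable now; certifies that the inlined witness W(d,t) is inhabited at d = c, i.e.
deg_B(a/c) ≤ c] BELYI'S MAP: for an abc triple take p = C(c^c)·X^a·(1−X)^b, q = C(a^a·b^b) (a
nonzero constant: IsCoprime p q, and q.natDegree = 0 < c = max natDegree gives the degree drop, ∞ ∈
β⁻¹(∞)). β = p/q = c^c x^a(1−x)^b/(a^a b^b) has β(0) = β(1) = 0, β(∞) = ∞, β(a/c) = 1, and β' =
k·x^{a−1}(1−x)^{b−1}(a − c·x) vanishes on ℂ∖{0,1} only at a/c, a simple zero of β', so p − q has the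
double root a/c and c − 2 simple roots, none equal to 0 or 1 (q ≠ 0 there). Hence the distinct roots
of p·q·(p−q) are {0,1} ∪ {a/c} ∪ {c−2 others}: exactly c + 1, and p·q·(p−q) vanishes at 0, 1, a/c.
Lean hints: a root of multiplicity ≥ 2 of p − q is a root of (p − q)' = p'
(Polynomial.rootMultiplicity, derivative); count roots.toFinset via the factorisation p − q =
−c^c·(X − a/c)²·r with r squarefree, r(0), r(1), r(a/c) ≠ 0. Sources: Belyi1980 (second proof),
Khadjavi2002 §1. -/
@[route_item "route-ABC-BelyiDegreeSmooth"]
def BelyiTrivialBound : Prop :=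
  ∀ a b c : ℕ, Literature.NumberTheory.DiophantineGeometry.IsABCTriple a b c → ∃ p q : Polynomial ℂ, IsCoprime p q ∧ max p.natDegree q.natDegree = c ∧ (p.natDegree < c ∨ q.natDegree < c ∨ (p - q).natDegree < c) ∧ (p * q * (p - q)).roots.toFinset.card = c + 1 ∧ (p * q * (p - q)).eval 0 = 0 ∧ (p * q * (p - q)).eval 1 = 0 ∧ (p * q * (p - q)).eval ((a : ℂ) / (c : ℂ)) = 0

/-- item stmt-ABC-2249 · support · rank 9 · closed · moot by None · by planner
sources: Beckmann1989, Zapponi2009BelyiDegree, Rodriguez2013, arXiv:0904.0967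
[support — THE CEILING of the technique class; named-fact territory (Beckmann's good-reduction
theorem); why the target is a waypoint, not Summit.ABC] If a/c (abc triple) has a Belyi witness of
degree d (normal form W(d, a/c)) then every prime ℓ | abc has ℓ ≤ d: deg_B(ℙ¹;0,1,∞,a/c) ≥ P(abc),
and rationals of Belyi degree ≤ d are d-smooth together with 1 − themselves. In print modulo
assembly: a complex witness is (up to a scalar) defined over ℚ̄ (three-point covers are rigid; 0,1,∞
special pins the Möbius ambiguity to finitely many choices); Beckmann1989: a Belyi pair with
monodromy group G has good reduction at p ∤ |G|, and |G| divides d!; under good (tame, p > d)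
reduction the d+2 special points specialise bijectively onto the d+2 special points of the reduced
degree-d Belyi map (Riemann–Hurwitz count in char p > d), so 0,1,∞,a/c stay distinct mod primes
above p > d: p ∤ abc. Printed forms: Zapponi2009BelyiDegree (deg_B ≥ greatest prime of stable bad
reduction), Rodriguez2013 Thm 3, Liţcanu 2004. With JavanpeykarFreyBound: a polynomial Javanpeykar
bound can never give more than log c ≪ poly(P(abc)) — the self-declared barrier, to be catalogued. -/
@[route_item "route-ABC-BelyiDegreeSmooth"]
def BeckmannFloor : Prop :=
  ∀ a b c d : ℕ, Literature.NumberTheory.DiophantineGeometry.IsABCTriple a b c → ∀ p q : Polynomial ℂ, IsCoprime p q → max p.natDegree q.natDegree = d → (p.natDegree < d ∨ q.natDegree < d ∨ (p - q).natDegree < d) → (p * q * (p - q)).roots.toFinset.card = d + 1 → (p * q * (p - q)).eval 0 = 0 → (p * q * (p - q)).eval 1 = 0 → (p * q * (p - q)).eval ((a : ℂ) / (c : ℂ)) = 0 → ∀ ℓ ∈ (a * b * c).primeFactors, ℓ ≤ d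

/-- item stmt-ABC-2250 · assembly · rank 1 · closed · moot by None · by planner
sources: Javanpeykar2014, LagariasSoundararajan2011
[assembly — pure real algebra, machine-checked by the planner (Sketch.lean, theorem assembly_holds,
rc 0): given BU's (K, C) and the chain's (C₁, C₂), every abc triple with prime factors ≤ P has a
witness of degree d ≤ C·P^K, so log c ≤ C₁d⁵ + C₂ ≤ (|C₁|·|C|⁵ + |C₂|)·P^{5K}, using P ≥ 2 (c ≥ 2
has a prime factor dividing abc). Target exponent 5K.] -/
@[route_item "route-ABC-BelyiDegreeSmooth"]
def Assembly : Prop :=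
  JavanpeykarFreyBound → SmoothBelyiUniformity → XYZLowerBound

end Summit.ABC.ABC.Theses.BelyiDegreeSmooth
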